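import Summits.ResolutionOfSingularities.ResolutionOfSingularities.Theorems.HomologicalConductorNoZenoRationalAscentTowerOfB
import Summits.ResolutionOfSingularities.ResolutionOfSingularities.Theorems.HomologicalConductorNoZenoRationalAscentProjective
import HarnessLib

/-!
# Crux `NoZenoR` (stmt-ResolutionOfSingularities-19943) — Lipman (1.2) 1) for NORMAL affine models of a RATIONAL surface
# germ, MODULO statement B) — binder-free ring form

Route `ResolutionOfSingularities/HomologicalConductor` (cell decomp-res, hand leafhand-res-homologicalconduct-12 g1).
OURS: AI-written, weaker than expert review; nothing here is a statement of the manuscript under review (Hironaka 2017).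
SUPPORT level (`--supports stmt-19943`), counted 0.  Def-free.  Named fact consumed: only the hypothesis
`(hB : Lipman1969_1_2_B)` (statement B) of Lipman's proof of (1.2), a special case of Zariski's Theorem (26.1)).

`hasRationalSingularity_of_isLocalization_of_B_normal` — **Lipman (1.2) 1) in the generality of the printed BASE** (`R` a
two-dimensional normal Noetherian local domain WITH A RATIONAL SINGULARITY, not necessarily regular) for a NORMAL finitely
generated birational model `B ⊇ R` (common denominator): EVERY localisation `T = B_𝔮` at a prime has a rational singularity
(a desingularization with `H¹ = 0`).  No regular-locus / J-2 / isolated-singularity / dimension binder: over the normal affine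
chart `Spec B ↪ W*` (projective model, `exists_projectiveModel_of_isAffine`) the bad points of the desingularization
`h : Z → W*` given by B) are finitely many closed points (`GenusDescent.exists_goodCover_isAffineOpen_mixed`, Zariski: the
fundamental locus has codimension two at normal points), so the «good cover» has AFFINE mixed pieces, and the fact-free core
`hasRationalSingularity_of_chart_of_isProjectiveOverRing` (projective Görtz–Wedhorn 24.44, p613816) applies with the chart
`h⁻¹(Spec B) → Spec B`; `H¹(Z, 𝒪_Z) = 0` is (1.2) 2) mod B) for the rational `R`
(`Lipman1969_1_2_B.hasTrivialCechH1_of_isResolution`).  This is Lipman's proof of (1.2) 1) (p. 200 with footnote (1))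
for a normal `W`, with EGA III (4.2.2) replaced by the projective case.

Consequence for the W4.4 chain: the stage-rationality feed needs only a NORMAL finitely generated `R`-model of the stage
`T_m` (the normalisation of `EssFiniteType.subalgebra R T_m` inside the normal `T_m`, finite by
`SyzygyFlattening.stub_essFiniteType_nrm`-type finiteness) instead of the J-2 binder of `…RationalAscentTowerOfB`.
No crux, kill test or summit statement is proved; resolution of singularities in positive characteristic is NOT proved.

## References
* J. Lipman, *Rational singularities …*, Publ. Math. IHÉS 36 (1969): Prop. (1.2) 1) and its proof, p. 200 with footnote (1);
  statement B) (p. 200). [Lipman1969]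
* O. Piltant, RACSAM 107 (2013), proof of Prop. 5.1, Step 3 (fundamental locus at normal points). [Piltant2013]
-/

-- single-problem summit: the doubled namespace component `ResolutionOfSingularities` is forced
set_option linter.dupNamespace false

noncomputable section

namespace Summit.ResolutionOfSingularities.ResolutionOfSingularities.Theorems.NoZeno.RationalAscent

open CategoryTheory CategoryTheory.Limits AlgebraicGeometry TopologicalSpace IsLocalRing
open Literature.AlgebraicGeometry.Resolution Literature.AlgebraicGeometry.Morphisms
open Summit.ResolutionOfSingularities.ResolutionOfSingularities.Theorems.SurfaceTermination.GenusDescent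
open Summit.ResolutionOfSingularities.ResolutionOfSingularities.Theorems.NoZeno.SandwichCluster

/-- **Lipman (1.2) 1) for NORMAL affine birational models of a RATIONAL two-dimensional normal local ring, MODULO B).**
`R` a two-dimensional normal Noetherian local domain with a rational singularity; `B ⊇ R` a NORMAL finitely generated
`R`-algebra and a domain with a common denominator `r ≠ 0` (so `Spec B → Spec R` is a birational affine model); then every
localisation `T = B_𝔮` at a prime ideal has a rational singularity (in the sense of Definition (1.1): a desingularization
`X → Spec T` with `H¹(X, 𝒪_X) = 0`).
[cite: Lipman1969, Proposition (1.2) 1), proof p. 200 with footnote (1); statement B) (p. 200)]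
[cite: Piltant2013, proof of Prop. 5.1, Step 3] -/
theorem hasRationalSingularity_of_isLocalization_of_B_normal (hB : Lipman1969_1_2_B.{0}) {R B T : Type}
    [CommRing R] [IsNoetherianRing R] [IsLocalRing R] [IsDomain R] [IsIntegrallyClosed R]
    (hdimR : ringKrullDim R = 2) (hratR : HasRationalSingularity R)
    [CommRing B] [IsDomain B] [IsIntegrallyClosed B] [Algebra R B] [Algebra.FiniteType R B]
    (hinj : Function.Injective (algebraMap R B)) (r : R) (hr : r ≠ 0)
    (hden : ∀ b : B, ∃ n : ℕ, ∃ a : R, algebraMap R B a = algebraMap R B r ^ n * b)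
    (𝔮 : Ideal B) [𝔮.IsPrime] [CommRing T] [Algebra B T] [IsLocalization.AtPrime T 𝔮] :
    HasRationalSingularity T := by
  classical
  haveI : IsNoetherianRing B := Algebra.FiniteType.isNoetherianRing R B
  haveI : IsDomain (CommRingCat.of B) := ‹IsDomain B›
  haveI : IsNoetherianRing (CommRingCat.of B) := ‹IsNoetherianRing B›
  haveI : IsIntegrallyClosed (CommRingCat.of B) := ‹IsIntegrallyClosed B›
  haveI : IsNoetherianRing (CommRingCat.of R) := ‹IsNoetherianRing R›
  haveI : IsLocalRing (CommRingCat.of R) := ‹IsLocalRing R›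
  haveI : IsDomain (CommRingCat.of R) := ‹IsDomain R›
  haveI : IsDomain T := IsLocalization.isDomain_of_le_nonZeroDivisors T (Ideal.primeCompl_le_nonZeroDivisors 𝔮)
  -- the birational affine model `g : Spec B → Spec R` and its projective model `W`
  let g : Spec (.of B) ⟶ Spec (.of R) := Spec.map (CommRingCat.ofHom (algebraMap R B))
  haveI : LocallyOfFiniteType g := by
    rw [HasRingHomProperty.Spec_iff (P := @LocallyOfFiniteType)]
    exact RingHom.finiteType_algebraMap.mpr ‹Algebra.FiniteType R B›
  have hbir : IsBirational g := isBirational_specMap_of_denominator hinj r hr hden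
  obtain ⟨W, hWint, j, hj, gW, hgW, hjg, hproj, hbirW⟩ := exists_projectiveModel_of_isAffine g hbir
  haveI := hWint
  haveI := hj
  haveI := hgW
  haveI : W.IsSeparated := ⟨by rw [← terminal.comp_from gW]; infer_instance⟩
  haveI : IsLocallyNoetherian W := LocallyOfFiniteType.isLocallyNoetherian gW
  haveI : CompactSpace W := QuasiCompact.compactSpace_of_compactSpace gW
  haveI : IsNoetherian W := {}
  -- statement B) on a desingularization of the rational `R`: `h : Z → W` with `H¹(Z, 𝒪_Z) = 0`
  obtain ⟨X, fX, hfX, -⟩ := id hratR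
  obtain ⟨Z, jZ, h, hjZ, hfac⟩ := hB R hdimR X fX hfX W gW hbirW
  haveI : IsProper jZ := hjZ.isProper
  haveI : IsProper fX := hfX.isProper
  have hres : IsResolution (jZ ≫ fX) := ⟨inferInstance, hjZ.isBirational.comp hfX.isBirational, hjZ.isRegular⟩
  have hZ0 : HasTrivialCechH1 (jZ ≫ fX) :=
    Lipman1969_1_2_B.hasTrivialCechH1_of_isResolution hB hdimR hratR _ hres
  have hZ : HasTrivialCechH1 (h ≫ gW) := by rw [hfac]; exact hZ0
  haveI : IsProper (h ≫ gW) := by rw [hfac]; infer_instance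
  haveI : IsProper h := IsProper.of_comp h gW
  haveI : IsIntegral Z := hres.isIntegral_source
  haveI : IsLocallyNoetherian Z := LocallyOfFiniteType.isLocallyNoetherian (h ≫ gW)
  haveI : CompactSpace Z := QuasiCompact.compactSpace_of_compactSpace (h ≫ gW)
  haveI : IsNoetherian Z := {}
  have hbirh : IsBirational h := isBirational_of_comp' hbirW (by rw [hfac]; exact hres.isBirational)
  have hZreg : Scheme.IsRegular Z := hjZ.isRegular
  -- dimensions `≤ 2`
  have hdimSpecR : topologicalKrullDim (Spec (.of R)) ≤ 2 := by
    change topologicalKrullDim (PrimeSpectrum R) ≤ 2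
    rw [PrimeSpectrum.topologicalKrullDim_eq_ringKrullDim]
    exact hdimR.le
  have hdimW : topologicalKrullDim W ≤ 2 := hbirW.topologicalKrullDim_le_of_isNoetherian.trans hdimSpecR
  have hdimZ : topologicalKrullDim Z ≤ 2 := by
    rw [← hfac] at hres
    exact hres.isBirational.topologicalKrullDim_le_of_isNoetherian.trans hdimSpecR
  -- the normal affine chart `W₀ = j(Spec B)` and the chart resolution `σ : h⁻¹W₀ → Spec B`
  obtain ⟨W₀, hW₀def⟩ : ∃ W₀ : W.Opens, W₀ = j.opensRange := ⟨_, rfl⟩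
  have hW₀ : IsAffineOpen W₀ := by rw [hW₀def]; exact isAffineOpen_opensRange j
  have hνC : Set.range j ⊆ (W₀ : Set W) := by rw [hW₀def]; exact subset_of_eq (Scheme.Hom.coe_opensRange j).symm
  let σ : ((h ⁻¹ᵁ W₀ : Z.Opens) : Scheme.{0}) ⟶ Spec (.of B) :=
    (h ∣_ W₀) ≫ (W.isoOfEq hW₀def).hom ≫ j.isoOpensRange.inv
  have htri : σ ≫ j = (h ⁻¹ᵁ W₀).ι ≫ h := by
    simp only [σ, Category.assoc, Scheme.Hom.isoOpensRange_inv_comp, Scheme.isoOfEq_hom_ι]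
    rw [morphismRestrict_ι]
  have hσ : IsResolution σ := by
    have h1 : IsResolution (h ∣_ W₀) := IsResolution.morphismRestrict ⟨inferInstance, hbirh, hZreg⟩ W₀
    haveI := h1.isProper
    exact ⟨inferInstance, h1.isBirational.comp_iso ((W.isoOfEq hW₀def).hom ≫ j.isoOpensRange.inv), h1.isRegular⟩
  haveI : IsProper σ := hσ.isProper
  -- the good cover: finitely many bad points of `σ` over the NORMAL `Spec B`, mixed pieces affine
  obtain ⟨α, _, Wc, a₀, hWa₀, hWaff, hWcov, hmixed⟩ := exists_goodCover_isAffineOpen_mixed h W₀ j σ gW hW₀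
    hdimW hdimZ hbirh hνC hσ.isBirational htri
  subst hWa₀
  have hvan : ∀ b, b ≠ a₀ → ∀ {κ : Type} (G : κ → Z.Opens), ⨆ i, G i = h ⁻¹ᵁ (Wc a₀ ⊓ Wc b) →
      cechZ1 (h ≫ gW) G ≤ cechB1 (h ≫ gW) G :=
    fun b hb κ G hG => cechZ1_le_cechB1_of_isAffineOpen_of_iSup_eq (h ≫ gW) (hmixed b hb) G hG
  -- the structure maps: `(h⁻¹W₀ ↪ Z → Spec R) = σ ≫ (Spec B → Spec R)`
  have hσT : (h ⁻¹ᵁ Wc a₀).ι ≫ (h ≫ gW) = σ ≫ Spec.map (CommRingCat.ofHom (algebraMap R B)) := by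
    change _ = σ ≫ g
    rw [← hjg, ← Category.assoc σ j gW, htri, Category.assoc]
  exact hasRationalSingularity_of_chart_of_isProjectiveOverRing hdimR.le (h ≫ gW) hZ gW hbirW hproj h rfl Wc hWaff
    hWcov a₀ hvan σ hσ hσT T 𝔮.primeCompl

end Summit.ResolutionOfSingularities.ResolutionOfSingularities.Theorems.NoZeno.RationalAscent

end
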